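import Literature.NumberTheory.GaloisRepresentations.CompatibleSystemResidualIrreducibility
import Literature.NumberTheory.GaloisRepresentations.SymplecticMultiplier
import HarnessLib

/-!
# A regular, odd symplectic, potentially diagonalizable `ℓ`-adic representation of `Γ_ℚ` of rank
# `4` with residually big image is a member of a compatible system
# (Barnet-Lamb–Gee–Geraghty–Taylor 2014, Thm. 5.5.1, over `ℚ`, `n = 4`, multiplier `ε⁻¹`,
# in the ordinary and in the Fontaine–Laffaille case of potential diagonalizability, Lemma 1.4.3)

Topic `Literature/NumberTheory/Automorphic` (the theorem is proved through potential automorphy,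
Thm. 4.5.1 / Cor. 4.5.2 ibid.); sibling of `PDAutomorphyLiftingGL4Rational`
(`BLGGT2014_thm421_rat_GL4`: same base `ℚ`, rank `4`, multiplier `ε_ℓ⁻¹`, whose binder style is
followed symbol for symbol where the two overlap).  Cite item of the crux `stmt-Langlands-17765`
(`Summit.Langlands.Langlands.Theses.AbelianSurfaceSerre.SerreGSp4Surjective`), line
`singer-type-evaporation`, stub `stub_singerFamily` (skeleton v4: the `ℓ`-adic COMPANIONS of the
`p`-adic ordinary lift, their crystallinity and labelled weights, and `CompanionAE`).  One NAMED
FACT (D-0014), `BLGGT2014_thm551_compatibleSystem_rat_GL4`, whose conclusion is an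
`IsWeaklyCompatibleSystemRat` (file `GaloisRepresentations/CompatibleSystemResidualIrreducibility`,
the vocabulary shared with `BLGGT2014_prop532_residuallyIrreducible_densityOne`), and its proved
projection `….exists_member`.

## The printed statements (held text arXiv:1010.2561, read 2026-08-17)

T. Barnet-Lamb, T. Gee, D. Geraghty, R. Taylor, *Potential automorphy and change of weight*,
Ann. of Math. 179 (2014) 501–609 [BarnetlambEtAl2014].  NUMBERING: the held text is the arXiv
version (§5.4 "Irreducibility results" there = §5.5 of the published version); the theorem below
is **Theorem 5.5.1 of the published paper = Theorem 5.4.1 of the held text** (so cited, as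
"Theorem 5.5.1 of [blggt] … is part of a weakly compatible system", by Patrikis–Taylor,
Compositio 151 (2015), proof of Thm. 2.1, arXiv:1307.1640 p. 9).

* **Theorem 5.4.1 (held) = 5.5.1 (published)** (pp. 39–40), verbatim: "Suppose that `F` is a CM
  (or totally real) field, that `n` is a positive integer and that `l ≥ 2(n+1)` is a rational
  prime such that `ζ_l ∉ F`. Suppose also that `μ : G_{F⁺} → ℚ̄_l^×` is a continuous character
  and that `r : G_F → GL_n(ℚ̄_l)` is a continuous representation. Suppose moreover that the
  following conditions are satisfied. (1) (Being unramified almost everywhere) `r` is unramified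
  at all but finitely many primes. (2) (Odd essential self-duality) `(r, μ)` is totally odd,
  essentially conjugate self-dual. (3) (Potential diagonalizability and regularity) `r` is
  potentially diagonalizable (and hence potentially crystalline) at each prime `v` of `F` above
  `l` and for each `τ : F ↪ ℚ̄_l` the multiset `HT_τ(r)` contains `n` distinct elements.
  (4) (Irreducibility) `r̄|_{G_{F(ζ_l)}}` is irreducible. Then `r` is part of a strictly pure
  compatible system of `l`-adic representations of `G_F`."  (Proof: Thm. 4.5.1 / Cor. 4.5.2 —
  potential automorphy over a Galois totally real `F'/F` — Brauer induction in the Grothendieck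
  group, [Caraiani2012] and [TaylorYoshida2007] Lemma 1.4 for strict purity; the members
  `r_{l',ı'}` are constructed for EVERY prime `l'` and EVERY `ı' : ℚ̄_{l'} ≅ ℂ`, with `r_{l,ı} ≅ r`.)
* **§5.1** (p. 32): weakly / strictly compatible systems, quoted in the vocabulary file; "strictly
  pure" ⊇ "strictly compatible" ⊇ "weakly compatible".
* **§2.1** (p. 17), `F` totally real: "`(r, μ)` is essentially conjugate self-dual if and only if
  `r` factors through `GSp_n(ℚ̄_l)` (if `μ(c_v) = −ε_v`) or `GO_n(ℚ̄_l)` (if `μ(c_v) = ε_v`) with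
  multiplier `μ`"; "totally odd, essentially conjugate self-dual if they are essentially conjugate
  self-dual and `ε_v = 1` for all `v ∣ ∞`".
* **Lemma 1.4.3** (p. 15), verbatim: "Suppose that `ρ : G_K → GL_n(ℚ̄_l)` is a potentially
  crystalline representation. (1) If `ρ` has a `G_K`-invariant filtration with one dimensional
  graded pieces, in particular if it is ordinary, then `ρ` is potentially diagonalizable. (2) If
  `K/ℚ_l` is unramified, if `ρ` is crystalline and if for each `τ : K ↪ L̄` the Hodge–Tate numbers
  `HT_τ(ρ₁) ⊂ [a_τ, a_τ + l − 2]` for some integer `a_τ`, then `ρ₁` is potentially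
  diagonalizable."  (§1.4, p. 13: "If `ρ` is ordinary … then it is de Rham".)
* Notation (p. 6): "`HT_τ(ε_l) = {−1}`"; "`Frob_K` … the geometric Frobenius".

So, over `ℚ`, for `n = 4`, `μ = ε_p⁻¹` and `l = p ≥ 11` (`≥ 2(n+1) = 10`; `ζ_p ∉ ℚ`), the printed
hypotheses are: `r : G_ℚ → GL₄(ℚ̄_p)` continuous, unramified at almost all primes, symplectic with
multiplier `ε_p⁻¹` (= "`(r, ε_p⁻¹)` totally odd essentially self-dual": `GSp₄` with
`μ(c) = ε_p⁻¹(c) = −1 = −ε_∞`, `ε_∞ = 1`); at `p` EITHER crystalline with Hodge–Tate numbers in an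
interval of length `p − 2` (Lemma 1.4.3 (2), `ℚ_p` unramified) OR potentially crystalline with a
`G_{ℚ_p}`-invariant full flag (Lemma 1.4.3 (1); e.g. ordinary), in both cases with `4` distinct
Hodge–Tate numbers; `r̄|_{G_{ℚ(ζ_p)}}` irreducible.  Conclusion: `r` is part of a strictly pure —
in particular WEAKLY — compatible system `𝓡`.

## Rendering in the tree's vocabulary (read before reviewing)

Binders follow `BLGGT2014_thm421_rat_GL4`.  Hypothesis by hypothesis:
* **`(r, ε_p⁻¹)` totally odd essentially self-dual** — `r.IsSymplecticWithMultiplierFun ν`,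
  `ν(g) = ε_p(g)⁻¹ ∈ ℚ̄_p` spelled exactly as in the sibling (and as the line's `cycInv p`).
  -- TODO(general form): general continuous multiplier `μ` with `μ(c) = −1`; the `GO_n` case.
* **Regularity** — a parameter `H : Multiset ℤ` with `H.Nodup`, `card H = 4` and the hypothesis
  that `H` IS the multiset of `τ`-labelled Hodge–Tate weights of `r` at the place `v ∣ p` for every
  `ℚ_p`-algebra label `τ : ℚ_v →ₐ[ℚ_p] ℚ̄_p` of the pinned datum `D = fontainePstAdicCompletion v p hv`
  (`labelledHodgeTateWeightsAt`, relative to `D.𝔅 = B_dR`; `r` is de Rham in both cases below, so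
  these ARE its Hodge–Tate numbers) — "`HT_τ(r)` contains `n` distinct elements".  `H` is then the
  common weight `{H_τ}` of the system (§5.1 (5)).
* **Potential diagonalizability at `p`**, as the disjunction of the two printed criteria of
  Lemma 1.4.3: (2) FONTAINE–LAFFAILLE — `D.IsCrystallineFramed (r.toLocal v)` and
  `H ⊂ [a, a + p − 2]` for some `a` (verbatim the sibling's clause); OR (1) FULL INVARIANT FLAG,
  POTENTIALLY CRYSTALLINE — `D.IsDeRhamFramed (r.toLocal v)`, every Weil–Deligne representation the
  datum attaches to `r|_{Γ_{ℚ_v}}` has `N = 0` (de Rham ⇒ potentially semistable, Berger;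
  potentially crystalline ⇔ `N = 0` on `D_pst`, Fontaine Exp. VIII §2.3.7 — verbatim the body of
  the requesting line's `PotentiallyCrystallineAt`), and in some frame `g ∈ GL₄(ℚ̄_p)` every
  `g r(σ) g⁻¹`, `σ ∈ Γ_{ℚ_v}`, is upper triangular ("a `G_K`-invariant filtration with one
  dimensional graded pieces"; the triangularity clause of the line's `PotentiallyOrdinaryAt`).
  -- TODO(general form): `IsPotentiallyDiagonalizable` over `PstCrystallineExtensionData` (accepted
  -- `PotentialDiagonalizability`) instead of the two criteria.
* **`r̄|_{G_{ℚ(ζ_p)}}` irreducible** — the sibling's clause: SOME continuous `ρbar : Γ_ℚ → GL₄(k)`,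
  `k` finite of characteristic `p`, and `red : 𝒪_{ℚ̄_p} → k̄` along which the integral
  characteristic polynomials of `r` reduce to those of `ρbar ⊗_k k̄`, with `ρbar ⊗_k k̄`
  irreducible on `ker ε̄_p` (`Representation.IsIrreducible`, `modPCyclotomicCharacterZMod`); any
  such `red` has kernel `𝔪` and `(ρbar ⊗ k̄)^{ss} ≅ r̄^{ss} ⊗ k̄` (Brauer–Nesbitt), so this is the
  printed hypothesis (the binders are in negative position: `∀ k ρbar red, reduces → irreducible →
  conclusion`).  `11 ≤ p` is "`l ≥ 2(n+1)`".
* **CONCLUSION** — there are a finite set `S` of places, complex Frobenius polynomials `Q v`,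
  `ι₀ : ℚ̄_p ≃ ℂ` and a family `𝓡 ℓ ι : Γ_ℚ → GL₄(ℚ̄_ℓ)` over ALL primes `ℓ` and ALL `ι : ℚ̄_ℓ ≃ ℂ`
  which is a weakly compatible system of weight `H` in the sense of `IsWeaklyCompatibleSystemRat`
  (coefficients of the `Q v` in one number field `E ⊂ ℂ`; members semisimple, unramified outside
  `S ∪ {ℓ}` with arithmetic-Frobenius polynomials `ι⁻¹(Q v)`, de Rham at `ℓ` with labelled weights
  `H`, crystalline at `ℓ` when the place of `ℓ` is not in `S`) and of which `r` IS the member at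
  `(p, ι₀)`: `𝓡 p ι₀ = r` ("`r` is part of").  This is the `(ℓ, ι)`-reparametrisation (vocabulary
  file, INDEXING) of the printed system: the proof's `ı` is `ι₀`, `M ⊂ ℂ` through `ı`, and
  `r_{l',ı'} = 𝓡 l' ı'`.  WEAKER than print in three documented respects:
  -- TODO(general form): strict compatibility (`WD_v(𝓡)` over `M̄` independent of `λ ∤ v`, §5.1)
  -- and purity / strict purity of weight `w` — the tree types `WD` at `v ∤ ℓ`
  -- (`IsWeilDeligneOfLadic`) but not yet its `λ`-independence across coefficient fields;
  -- TODO(general form): totally real / CM `F`, general `n`.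
* **What the conclusion does NOT say (because print does not): self-duality of the OTHER
  members.**  The printed conclusion is "`r` is part of a strictly pure compatible system"; it
  does not assert that `(r_λ, ε_λ⁻¹)` is essentially self-dual, let alone symplectic, for
  `λ ∤ p`.  On paper a consumer recovers `𝓡 ℓ ι ≅ (𝓡 ℓ ι)^∨ ⊗ ε_ℓ⁻¹` from the system alone (the
  root multiset of `Q v` is stable under `α ↦ (q_v α)⁻¹`, as it is at `(p, ι₀)` where `r` is
  symplectic with multiplier `ε_p⁻¹`; then Chebotarev and Brauer–Nesbitt for the semisimple
  members — accepted `chebotarev_artinRep_holds`-type density and `brauerNesbitt_holds`), and for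
  an absolutely irreducible member the pairing is unique up to scalars, hence of a definite sign;
  that the sign is symplectic is a further theorem (potential automorphy over `F'` plus
  Bellaïche–Chenevier's sign theorem, as quoted in [BLGGT] §2.1 for `r_{l,ı}(π)`), NOT vendored here.
* NOT here either: the potential automorphy of `r` over a Galois totally real `F'/ℚ` through
  which the theorem is proved (Cor. 4.5.2; Theorem C of the Introduction), and Prop. 5.3.2
  (residual irreducibility of the members at a density-one set of `ℓ`: the vocabulary file).

## References

* [BarnetlambEtAl2014] Ann. of Math. 179 (2014): Thm. 5.5.1 (= arXiv:1010.2561 Thm. 5.4.1,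
  pp. 39–40), Lemma 1.4.3 (p. 15), §1.4 (p. 13), §2.1 (p. 17), §5.1 (p. 32), Thm. 4.5.1 and
  Cor. 4.5.2 (the proof).
* [Caraiani2012] A. Caraiani, Duke Math. J. 161 (2012) (local–global compatibility, purity: the
  strict purity in the proof).  [TaylorYoshida2007] R. Taylor, T. Yoshida, J. Amer. Math. Soc. 20
  (2007), Lemma 1.4 (pure Weil–Deligne representations).
* [PatrikisTaylor2014] Compositio Math. 151 (2015), proof of Thm. 2.1 (p. 9 of arXiv:1307.1640:
  the citation fixing the published numbering 5.5.1 / 5.3.2).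
-/

noncomputable section

open scoped MatrixGroups Matrix NumberField
open NumberField IsDedekindDomain Field Filter

namespace Literature.NumberTheory.Automorphic

open Literature.NumberTheory.GaloisRepresentations

/-- **Barnet-Lamb–Gee–Geraghty–Taylor 2014, Theorem 5.5.1 (= arXiv:1010.2561 Thm. 5.4.1), for
`GL₄` over `ℚ`, multiplier `ε_p⁻¹`, with Lemma 1.4.3 for potential diagonalizability.**
Let `p ≥ 11` be prime, `r : Γ_ℚ → GL₄(ℚ̄_p)` continuous, unramified at all but finitely many
places, SYMPLECTIC WITH MULTIPLIER `ε_p⁻¹` (so `(r, ε_p⁻¹)` is totally odd essentially self-dual),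
and `H` a multiset of FOUR DISTINCT integers which is the multiset of `τ`-labelled Hodge–Tate
weights of `r` at the place `v ∣ p` for every `ℚ_p`-label `τ` (pinned datum
`fontainePstAdicCompletion v p hv`).  Suppose that at `v ∣ p` EITHER `r` is crystalline with
`H ⊂ [a, a + p − 2]` (Fontaine–Laffaille, Lemma 1.4.3 (2)) OR `r` is potentially crystalline (de
Rham, `N = 0` on every attached Weil–Deligne representation) with a `Γ_{ℚ_v}`-invariant full flag
(upper triangular in some frame; Lemma 1.4.3 (1), e.g. ordinary) — so `r|_{Γ_{ℚ_p}}` is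
potentially diagonalizable with `4` distinct Hodge–Tate numbers.  Suppose the residual
representation — some continuous `ρbar : Γ_ℚ → GL₄(k)`, `k` finite of characteristic `p`, to
whose base change to `k̄` the integral characteristic polynomials of `r` reduce along a ring
homomorphism `red : 𝒪_{ℚ̄_p} → k̄` — is irreducible on `Γ_{ℚ(ζ_p)} = ker ε̄_p`.  Then `r` IS A
MEMBER OF A WEAKLY COMPATIBLE SYSTEM: there are a finite set `S` of finite places of `ℚ`, complex
polynomials `Q v`, `ι₀ : ℚ̄_p ≃ ℂ` and representations `𝓡 ℓ ι : Γ_ℚ → GL₄(ℚ̄_ℓ)` for every prime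
`ℓ` and every `ι : ℚ̄_ℓ ≃ ℂ`, forming a weakly compatible system of weight `H` over `ℚ`
(`IsWeaklyCompatibleSystemRat 4 S Q H 𝓡`: the `Q v`, `v ∉ S`, have coefficients in one number
field `E ⊂ ℂ`; every member is semisimple, unramified at `v ∉ S`, `v ∤ ℓ`, with
arithmetic-Frobenius characteristic polynomial `ι⁻¹(Q v)` there, de Rham at `ℓ` with labelled
Hodge–Tate weights `H`, and crystalline at `ℓ` when the place of `ℓ` is not in `S`), with
`𝓡 p ι₀ = r`.  Printed conclusion: "`r` is part of a strictly pure compatible system of `l`-adic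
representations of `G_F`" — strict compatibility and purity are dropped (weaker), and NO
self-duality of the members other than `r` is asserted (print asserts none; module docstring).
Named fact (D-0014); users take `(h : BLGGT2014_thm551_compatibleSystem_rat_GL4)`.
-- TODO(general form): totally real / CM `F`, general `n` and multiplier `μ`, `GO_n`; potential
-- diagonalizability as such; strictly pure compatible system (`WD_v` independent of `λ`, purity).
[cite: BarnetlambEtAl2014, Thm. 5.5.1 (= arXiv:1010.2561 Thm. 5.4.1) with Lemma 1.4.3, §2.1 and §5.1] -/
def BLGGT2014_thm551_compatibleSystem_rat_GL4 : Prop :=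
  ∀ (p : ℕ) [Fact p.Prime], 11 ≤ p →
    ∀ (r : FramedGaloisRep ℚ (PadicAlgCl p) 4) (H : Multiset ℤ),
      -- `r` is unramified at all but finitely many primes
      (∀ᶠ v : HeightOneSpectrum (𝓞 ℚ) in cofinite, r.IsUnramifiedAt v) →
      -- `(r, ε_p⁻¹)` totally odd essentially self-dual: symplectic with multiplier `ε_p⁻¹`
      r.IsSymplecticWithMultiplierFun (fun g => algebraMap ℚ_[p] (PadicAlgCl p)
        ((((GaloisRep.cyclotomicCharacter ℚ p g)⁻¹ : ℤ_[p]ˣ) : ℤ_[p]) : ℚ_[p])) →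
      -- regularity: `H` has four distinct elements …
      H.Nodup → Multiset.card H = 4 →
      -- … and is the multiset of labelled Hodge–Tate weights of `r` at `v ∣ p`; there `r` is
      -- potentially diagonalizable by Lemma 1.4.3: (2) Fontaine–Laffaille, or (1) potentially
      -- crystalline with an invariant full flag
      (∀ (v : HeightOneSpectrum (𝓞 ℚ)) (hv : ((p : ℕ) : 𝓞 ℚ) ∈ v.asIdeal),
        let D := PAdicHodge.fontainePstAdicCompletion v p hv
        (letI := D.algebra
         ∀ τ : v.adicCompletion ℚ →ₐ[ℚ_[p]] PadicAlgCl p,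
          r.labelledHodgeTateWeightsAt v D.algebra D.𝔅 τ.toRingHom = H) ∧
        ((D.IsCrystallineFramed (r.toLocal v) ∧
            ∃ a : ℤ, ∀ h ∈ H, a ≤ h ∧ h ≤ a + ((p : ℤ) - 2)) ∨
          (D.IsDeRhamFramed (r.toLocal v) ∧
            (∀ W, D.IsWeilDeligneOf (r.toLocal v) W → W.N = 0) ∧
            ∃ g : GL (Fin 4) (PadicAlgCl p),
              ∀ (σ : absoluteGaloisGroup (v.adicCompletion ℚ)) (i j : Fin 4), j < i →
                ((g * r.toLocal v σ * g⁻¹ : GL (Fin 4) (PadicAlgCl p)) :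
                  Matrix (Fin 4) (Fin 4) (PadicAlgCl p)) i j = 0))) →
      -- the residual representation `r̄`, read in `k̄` for a finite field `k` of characteristic `p`
      ∀ (k : Type) [Field k] [Fintype k] [CharP k p] [TopologicalSpace k] [DiscreteTopology k]
        (ρbar : FramedGaloisRep ℚ k 4)
        (red : (Valued.v : Valuation (PadicAlgCl p) NNReal).valuationSubring →+*
          AlgebraicClosure k),
        (∀ g : absoluteGaloisGroup ℚ,
          ∃ P : Polynomial (Valued.v : Valuation (PadicAlgCl p) NNReal).valuationSubring,
            P.map (Valued.v : Valuation (PadicAlgCl p) NNReal).valuationSubring.subtype =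
                FramedRep.charpoly r g ∧
              P.map red = (FramedRep.charpoly ρbar g).map (algebraMap k (AlgebraicClosure k))) →
        -- `r̄|_{Γ_{ℚ(ζ_p)}}` is irreducible (`Γ_{ℚ(ζ_p)} = ker ε̄_p`)
        Representation.IsIrreducible
          (((FramedRep.baseChangeRepresentation (algebraMap k (AlgebraicClosure k)) ρbar).comp
              (modPCyclotomicCharacterZMod ℚ p).ker.subtype :
            Representation (AlgebraicClosure k) (modPCyclotomicCharacterZMod ℚ p).ker
              (Fin 4 → AlgebraicClosure k))) →
      -- CONCLUSION: `r` is the `(p, ι₀)`-member of a weakly compatible system of weight `H`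
      ∃ (S : Finset (HeightOneSpectrum (𝓞 ℚ))) (Q : HeightOneSpectrum (𝓞 ℚ) → Polynomial ℂ)
        (ι₀ : PadicAlgCl p ≃+* ℂ)
        (𝓡 : ∀ (ℓ : ℕ) [Fact ℓ.Prime], (PadicAlgCl ℓ ≃+* ℂ) → FramedGaloisRep ℚ (PadicAlgCl ℓ) 4),
        𝓡 p ι₀ = r ∧ IsWeaklyCompatibleSystemRat 4 S Q H 𝓡

/-- Projection of `BLGGT2014_thm551_compatibleSystem_rat_GL4` onto the two clauses the requesting
line reads off first: `r` itself is unramified with arithmetic-Frobenius polynomial `ι₀⁻¹(Q v)` at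
every `v ∉ S`, `v ∤ p`, and so is every member `𝓡 ℓ ι` at `v ∉ S`, `v ∤ ℓ` (with `ι⁻¹(Q v)`) — the
raw material of the line's `CompanionAE` (take `ι := ι' ∘ ι⁻¹ ∘ ι₀` and the uniqueness of
Frobenius polynomials). [folklore] -/
theorem BLGGT2014_thm551_compatibleSystem_rat_GL4.exists_member
    (h : BLGGT2014_thm551_compatibleSystem_rat_GL4) {p : ℕ} [Fact p.Prime] (hp : 11 ≤ p)
    (r : FramedGaloisRep ℚ (PadicAlgCl p) 4) (H : Multiset ℤ)
    (hunr : ∀ᶠ v : HeightOneSpectrum (𝓞 ℚ) in cofinite, r.IsUnramifiedAt v)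
    (hsymp : r.IsSymplecticWithMultiplierFun (fun g => algebraMap ℚ_[p] (PadicAlgCl p)
        ((((GaloisRep.cyclotomicCharacter ℚ p g)⁻¹ : ℤ_[p]ˣ) : ℤ_[p]) : ℚ_[p])))
    (hreg : H.Nodup) (hcard : Multiset.card H = 4)
    (hp_adic : ∀ (v : HeightOneSpectrum (𝓞 ℚ)) (hv : ((p : ℕ) : 𝓞 ℚ) ∈ v.asIdeal),
        let D := PAdicHodge.fontainePstAdicCompletion v p hv
        (letI := D.algebra
         ∀ τ : v.adicCompletion ℚ →ₐ[ℚ_[p]] PadicAlgCl p,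
          r.labelledHodgeTateWeightsAt v D.algebra D.𝔅 τ.toRingHom = H) ∧
        ((D.IsCrystallineFramed (r.toLocal v) ∧
            ∃ a : ℤ, ∀ h ∈ H, a ≤ h ∧ h ≤ a + ((p : ℤ) - 2)) ∨
          (D.IsDeRhamFramed (r.toLocal v) ∧
            (∀ W, D.IsWeilDeligneOf (r.toLocal v) W → W.N = 0) ∧
            ∃ g : GL (Fin 4) (PadicAlgCl p),
              ∀ (σ : absoluteGaloisGroup (v.adicCompletion ℚ)) (i j : Fin 4), j < i →
                ((g * r.toLocal v σ * g⁻¹ : GL (Fin 4) (PadicAlgCl p)) :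
                  Matrix (Fin 4) (Fin 4) (PadicAlgCl p)) i j = 0)))
    {k : Type} [Field k] [Fintype k] [CharP k p] [TopologicalSpace k] [DiscreteTopology k]
    (ρbar : FramedGaloisRep ℚ k 4)
    (red : (Valued.v : Valuation (PadicAlgCl p) NNReal).valuationSubring →+* AlgebraicClosure k)
    (hred : ∀ g : absoluteGaloisGroup ℚ,
        ∃ P : Polynomial (Valued.v : Valuation (PadicAlgCl p) NNReal).valuationSubring,
          P.map (Valued.v : Valuation (PadicAlgCl p) NNReal).valuationSubring.subtype =
              FramedRep.charpoly r g ∧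
            P.map red = (FramedRep.charpoly ρbar g).map (algebraMap k (AlgebraicClosure k)))
    (hbig : Representation.IsIrreducible
        (((FramedRep.baseChangeRepresentation (algebraMap k (AlgebraicClosure k)) ρbar).comp
            (modPCyclotomicCharacterZMod ℚ p).ker.subtype :
          Representation (AlgebraicClosure k) (modPCyclotomicCharacterZMod ℚ p).ker
            (Fin 4 → AlgebraicClosure k)))) :
    ∃ (S : Finset (HeightOneSpectrum (𝓞 ℚ))) (Q : HeightOneSpectrum (𝓞 ℚ) → Polynomial ℂ)
      (ι₀ : PadicAlgCl p ≃+* ℂ)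
      (𝓡 : ∀ (ℓ : ℕ) [Fact ℓ.Prime], (PadicAlgCl ℓ ≃+* ℂ) → FramedGaloisRep ℚ (PadicAlgCl ℓ) 4),
      𝓡 p ι₀ = r ∧ IsWeaklyCompatibleSystemRat 4 S Q H 𝓡 ∧
        (∀ v : HeightOneSpectrum (𝓞 ℚ), v ∉ S → ((p : ℕ) : 𝓞 ℚ) ∉ v.asIdeal →
          r.IsUnramifiedAt v ∧
            r.HasFrobCharpolyAt v ((Q v).map (ι₀.symm : ℂ ≃+* PadicAlgCl p).toRingHom)) ∧
        ∀ (ℓ : ℕ) [Fact ℓ.Prime] (ι : PadicAlgCl ℓ ≃+* ℂ) (v : HeightOneSpectrum (𝓞 ℚ)),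
          v ∉ S → ((ℓ : ℕ) : 𝓞 ℚ) ∉ v.asIdeal →
            (𝓡 ℓ ι).IsUnramifiedAt v ∧
              (𝓡 ℓ ι).HasFrobCharpolyAt v ((Q v).map (ι.symm : ℂ ≃+* PadicAlgCl ℓ).toRingHom) := by
  obtain ⟨S, Q, ι₀, 𝓡, hr, h𝓡⟩ := h p hp r H hunr hsymp hreg hcard hp_adic k ρbar red hred hbig
  refine ⟨S, Q, ι₀, 𝓡, hr, h𝓡, fun v hvS hvp => ?_,
    fun ℓ _ ι v hvS hvℓ => (h𝓡.member ℓ ι).2.1 v hvS hvℓ⟩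
  have := (h𝓡.member p ι₀).2.1 v hvS hvp
  rwa [hr] at this

end Literature.NumberTheory.Automorphic

end
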